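import Summits.ResolutionOfSingularities.ResolutionOfSingularities.Theorems.PurelyInseparableDim4ParamLiftPairs
import HarnessLib

/-!
# [OURS · res-dim4-pi · F4-C-loc] PARAMETRIC LIFT KIT, part 4: the RELATION check — a binomial two-source constraint on
  B's fibre coordinates whose non-degenerate branch is killed by a second low exponent

Cell `res-dim4-pi` (D-0157 DOOR 2, wave 2), seat `res-dim4-p-6` g3; sequel of `…ParamLiftPairs` (`moves`, `binomK`,
`pterm_eq`).  Shape met by the seat's symbolic census (WORD #92 (d)) e.g. at `x₃²x₄² + x₂²x₃x₄` (centre `V(x₂,x₃,x₄)`,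
`x₂`-chart: the coefficient of `x₂x₄` is `b₂(1 − b₂b₃)`, that of `x₂` is `b₂b₃(1 + b₂b₃)`: on `b₂b₃ = 1` the
second is `2 ≠ 0`, so `b₂ = 0`):

* **`relCoreB` / `relKillB` / `prelB` ⇒ `exists_zero_of_prelB`**: the sources of `γ` are two single terms `A·b^μ`,
  `B·b^{μ+ν}` (`ν ≠ 0`, same power of the letter, non-zero binomials); then an equimultiple point has `bᵢ = 0` for some
  `i ∈ supp μ` (`= zs`) — because on the other branch (`∏ b^ν = κ := −A/B`, all of `zs` non-zero, hence all of
  `supp ν` non-zero too) the checker exhibits a second low exponent `γ'` whose sources move only inside `zs ∪ supp ν` and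
  are ONE single term, or an ordered binomial pair with the same excess `ν` and `cE·K₁' + cF·K₂'·κ ≠ 0` — a non-zero
  coefficient where equimultiplicity wants zero.  Either list order of the two sources is accepted.

No relation among letters is carried forward (the relation branch is refuted on the spot).  [OURS · counted 0 ·
instrument; AI kernel work, weaker than expert review.]  NOTHING here is a statement about resolution of singularities;
resolution in dimension `≥ 4` / characteristic `p > 0` is NOT proved by anything in this file.  bears_on:
LADDER-RESOLUTION:D157-DOOR2 (res-dim4-pi · F4-C-loc all fields · parametric rows).  Host item (DR-157-C):
`stmt-ResolutionOfSingularities-16155`, helper.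
-/

set_option linter.dupNamespace false -- mandated namespace of this single-conjunct summit

noncomputable section

open MvPolynomial Finset
open scoped BigOperators

namespace Summit.ResolutionOfSingularities.ResolutionOfSingularities.Theorems.PIDim4

namespace ParamLift

open Literature.AlgebraicGeometry.Resolution
open Literature.AlgebraicGeometry.Resolution.CentreBlowup
open StepKit

variable {k K : Type} [Field k] [Field K] [DecidableEq k] [DecidableEq K] (f : k →+* K) (β : K)

/-! ## §7 The RELATION check: a binomial two-source constraint and its dead branch -/

/-- core of the relation check for an ORDERED pair `t₁ ≤ t₂` (x-parts): same power of the letter, non-zero binomials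
and coefficients, `zs` = the moving coordinates of `t₁`, `nu` = the (non-zero) excess of `t₂` over `t₁`,
`κ·(c₂K₂) = −(c₁K₁)`. OURS. [folklore] -/
def relCoreB (γ : Fin 4 → ℕ) (zs : Finset (Fin 4)) (nu : Fin 4 → ℕ) (κ : k) (t₁ t₂ : (Fin 5 → ℕ) × k) : Bool :=
  decide (∀ m : Fin 4, t₁.1 m.castSucc ≤ t₂.1 m.castSucc) && decide (t₁.1 (Fin.last 4) = t₂.1 (Fin.last 4)) &&
    decide (moves γ t₁.1 = zs) && decide (∀ m : Fin 4, nu m = t₂.1 m.castSucc - t₁.1 m.castSucc) && !decide (nu = 0) &&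
    !decide (t₁.2 * binomK γ t₁.1 = 0) && !decide (t₂.2 * binomK γ t₂.1 = 0) &&
    decide (κ * (t₂.2 * binomK γ t₂.1) = -(t₁.2 * binomK γ t₁.1))

/-- the killing exponent's check on the relation branch: its sources move only inside `N = zs ∪ supp nu` and are ONE
single term, or an ordered binomial pair with the same excess `nu` and `cE·K₁' + cF·K₂'·κ ≠ 0`. OURS. [folklore] -/
def relKillB (γ' : Fin 4 → ℕ) (N : Finset (Fin 4)) (nu : Fin 4 → ℕ) (κ : k) : Terms 5 k → Bool
  | [u] => decide (moves γ' u.1 ⊆ N) && !decide (u.2 * binomK γ' u.1 = 0)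
  | [u₁, u₂] =>
    (decide (moves γ' u₂.1 ⊆ N) && decide (∀ m : Fin 4, u₁.1 m.castSucc ≤ u₂.1 m.castSucc) &&
      decide (u₁.1 (Fin.last 4) = u₂.1 (Fin.last 4)) &&
      decide (∀ m : Fin 4, nu m = u₂.1 m.castSucc - u₁.1 m.castSucc) &&
      !decide (u₁.2 * binomK γ' u₁.1 + u₂.2 * binomK γ' u₂.1 * κ = 0)) ||
    (decide (moves γ' u₁.1 ⊆ N) && decide (∀ m : Fin 4, u₂.1 m.castSucc ≤ u₁.1 m.castSucc) &&
      decide (u₂.1 (Fin.last 4) = u₁.1 (Fin.last 4)) &&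
      decide (∀ m : Fin 4, nu m = u₁.1 m.castSucc - u₂.1 m.castSucc) &&
      !decide (u₂.2 * binomK γ' u₂.1 + u₁.2 * binomK γ' u₁.1 * κ = 0))
  | _ => false

/-- **relation check**: `γ`, `γ'` low; the sources of `γ` form an ordered binomial pair (either list order) with data
`(zs, nu, κ)`; the sources of `γ'` pass `relKillB`. OURS. [folklore] -/
def prelB (q : ℕ) (U : Finset (Fin 4)) (G : Terms 5 k) (γ γ' : Fin 4 → ℕ) (zs : Finset (Fin 4)) (nu : Fin 4 → ℕ)
    (κ : k) : Bool :=
  !decide (γ = 0) && decide (∑ m, γ m < q) && !decide (γ' = 0) && decide (∑ m, γ' m < q) && decide (zs ⊆ U) &&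
    (match srcTerms U γ G with
      | [t₁, t₂] => relCoreB γ zs nu κ t₁ t₂ || relCoreB γ zs nu κ t₂ t₁
      | _ => false) &&
    relKillB γ' (zs ∪ Finset.univ.filter fun m => nu m ≠ 0) nu κ (srcTerms U γ' G)

omit [Field K] [DecidableEq K] in
/-- the low-exponent data of a relation check. OURS. [folklore] -/
theorem prelB_low {q : ℕ} {U : Finset (Fin 4)} {G : Terms 5 k} {γ γ' : Fin 4 → ℕ} {zs : Finset (Fin 4)}
    {nu : Fin 4 → ℕ} {κ : k} (h : prelB q U G γ γ' zs nu κ = true) :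
    (γ ≠ 0 ∧ ∑ m, γ m < q) ∧ (γ' ≠ 0 ∧ ∑ m, γ' m < q) := by
  unfold prelB at h
  simp only [Bool.and_eq_true, Bool.not_eq_true', decide_eq_false_iff_not, decide_eq_true_eq] at h
  exact ⟨⟨h.1.1.1.1.1.1, h.1.1.1.1.1.2⟩, h.1.1.1.1.2, h.1.1.1.2⟩

omit [DecidableEq k] [DecidableEq K] in
/-- the `b`-product of a source is the product over its moving coordinates' excesses; if all letters in `moves` are
non-zero the product is non-zero. OURS. [folklore] -/
theorem prod_pow_ne_zero {γ : Fin 4 → ℕ} {e : Fin 5 → ℕ} {b : Fin 4 → K}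
    (h : ∀ m ∈ moves γ e, b m ≠ 0) : (∏ m : Fin 4, b m ^ (e m.castSucc - γ m)) ≠ 0 := by
  refine Finset.prod_ne_zero_iff.mpr fun m _ => ?_
  by_cases hm : γ m < e m.castSucc
  · exact pow_ne_zero _ (h m (by simpa [moves] using hm))
  · rw [Nat.sub_eq_zero_of_le (not_lt.mp hm), pow_zero]; exact one_ne_zero

omit [DecidableEq k] [DecidableEq K] in
/-- for an ordered pair `t₁ ≤ t₂` with excess `nu`, the `b`-product of `t₂` is that of `t₁` times `∏ b^nu`.
OURS. [folklore] -/
theorem prod_pow_pair {γ : Fin 4 → ℕ} {t₁ t₂ : Fin 5 → ℕ} {nu : Fin 4 → ℕ} (hle : ∀ i : Fin 4, γ i ≤ t₁ i.castSucc)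
    (h12 : ∀ m : Fin 4, t₁ m.castSucc ≤ t₂ m.castSucc) (hnu : ∀ m : Fin 4, nu m = t₂ m.castSucc - t₁ m.castSucc)
    (b : Fin 4 → K) :
    (∏ m : Fin 4, b m ^ (t₂ m.castSucc - γ m)) =
      (∏ m : Fin 4, b m ^ (t₁ m.castSucc - γ m)) * ∏ m : Fin 4, b m ^ nu m := by
  rw [← Finset.prod_mul_distrib]
  refine Finset.prod_congr rfl fun m _ => ?_
  rw [← pow_add, hnu m]
  congr 1
  have := hle m; have := h12 m; omega

omit [DecidableEq K] in
/-- ordered binomial pair ⇒ on the branch where all of `zs` is non-zero, `∏ b^nu = f κ`. OURS. [folklore] -/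
theorem prod_nu_eq_of_relCoreB {γ : Fin 4 → ℕ} {zs : Finset (Fin 4)} {nu : Fin 4 → ℕ} {κ : k}
    {t₁ t₂ : (Fin 5 → ℕ) × k} (hβ : β ≠ 0) (h : relCoreB γ zs nu κ t₁ t₂ = true)
    (hsrc : ∀ i : Fin 4, γ i ≤ t₁.1 i.castSucc) {b : Fin 4 → K} (hz : ∀ m ∈ zs, b m ≠ 0)
    (hzero : pterm f β γ b t₁ + pterm f β γ b t₂ = 0) : (∏ m : Fin 4, b m ^ nu m) = f κ := by
  simp only [relCoreB, Bool.and_eq_true, decide_eq_true_eq, Bool.not_eq_true', decide_eq_false_iff_not] at h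
  obtain ⟨⟨⟨⟨⟨⟨⟨h12, ht⟩, hmv⟩, hnu⟩, -⟩, hA⟩, hB⟩, hκ⟩ := h
  rw [pterm_eq, pterm_eq, prod_pow_pair hsrc h12 hnu, ht] at hzero
  have hP : (∏ m : Fin 4, b m ^ (t₁.1 m.castSucc - γ m)) ≠ 0 := prod_pow_ne_zero fun m hm => hz m (hmv ▸ hm)
  have hAK : f (t₁.2 * binomK γ t₁.1) ≠ 0 := (map_ne_zero_iff f f.injective).mpr hA
  have hBK : f (t₂.2 * binomK γ t₂.1) ≠ 0 := (map_ne_zero_iff f f.injective).mpr hB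
  have hβa : β ^ t₂.1 (Fin.last 4) ≠ 0 := pow_ne_zero _ hβ
  apply mul_left_cancel₀ (mul_ne_zero (mul_ne_zero hBK hβa) hP)
  rw [map_mul] at hAK hBK ⊢
  have hκ' : f κ * (f t₂.2 * f (binomK γ t₂.1)) = -(f t₁.2 * f (binomK γ t₁.1)) := by
    rw [← map_mul, ← map_mul, ← map_mul, hκ, map_neg, map_mul]
  linear_combination hzero - β ^ t₂.1 (Fin.last 4) * (∏ m : Fin 4, b m ^ (t₁.1 m.castSucc - γ m)) * hκ'

omit [Field K] [DecidableEq K] in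
/-- the relation value is non-zero. OURS. [folklore] -/
theorem kappa_ne_zero_of_relCoreB {γ : Fin 4 → ℕ} {zs : Finset (Fin 4)} {nu : Fin 4 → ℕ} {κ : k}
    {t₁ t₂ : (Fin 5 → ℕ) × k} (h : relCoreB γ zs nu κ t₁ t₂ = true) : κ ≠ 0 := by
  simp only [relCoreB, Bool.and_eq_true, decide_eq_true_eq, Bool.not_eq_true', decide_eq_false_iff_not] at h
  obtain ⟨⟨⟨-, hA⟩, -⟩, hκ⟩ := h
  intro h0
  rw [h0, zero_mul] at hκ
  exact hA (neg_eq_zero.mp hκ.symm)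

omit [DecidableEq K] in
/-- on the relation branch the killing exponent's coefficient is NON-ZERO. OURS. [folklore] -/
theorem sum_ne_zero_of_relKillB {γ' : Fin 4 → ℕ} {N : Finset (Fin 4)} {nu : Fin 4 → ℕ} {κ : k}
    {Ts : Terms 5 k} (hβ : β ≠ 0) (h : relKillB γ' N nu κ Ts = true) (hsrc : ∀ u ∈ Ts, ∀ i : Fin 4, γ' i ≤ u.1 i.castSucc)
    {b : Fin 4 → K} (hN : ∀ m ∈ N, b m ≠ 0) (hnu : (∏ m : Fin 4, b m ^ nu m) = f κ) :
    (Ts.map (pterm f β γ' b)).sum ≠ 0 := by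
  unfold relKillB at h
  split at h
  · rename_i u
    simp only [Bool.and_eq_true, decide_eq_true_eq, Bool.not_eq_true', decide_eq_false_iff_not] at h
    obtain ⟨hmv, hE⟩ := h
    simp only [List.map_cons, List.map_nil, List.sum_cons, List.sum_nil, add_zero]
    rw [pterm_eq]
    exact mul_ne_zero (mul_ne_zero (mul_ne_zero ((map_ne_zero_iff f f.injective).mpr (left_ne_zero_of_mul hE))
      (pow_ne_zero _ hβ)) ((map_ne_zero_iff f f.injective).mpr (right_ne_zero_of_mul hE)))
      (prod_pow_ne_zero fun m hm => hN m (hmv hm))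
  · rename_i u₁ u₂
    simp only [List.map_cons, List.map_nil, List.sum_cons, List.sum_nil, add_zero]
    rw [Bool.or_eq_true] at h
    have key : ∀ {v₁ v₂ : (Fin 5 → ℕ) × k}, (∀ i : Fin 4, γ' i ≤ v₁.1 i.castSucc) →
        (decide (moves γ' v₂.1 ⊆ N) && decide (∀ m : Fin 4, v₁.1 m.castSucc ≤ v₂.1 m.castSucc) &&
          decide (v₁.1 (Fin.last 4) = v₂.1 (Fin.last 4)) &&
          decide (∀ m : Fin 4, nu m = v₂.1 m.castSucc - v₁.1 m.castSucc) &&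
          !decide (v₁.2 * binomK γ' v₁.1 + v₂.2 * binomK γ' v₂.1 * κ = 0)) = true →
        pterm f β γ' b v₁ + pterm f β γ' b v₂ ≠ 0 := by
      intro v₁ v₂ hle hh
      simp only [Bool.and_eq_true, decide_eq_true_eq, Bool.not_eq_true', decide_eq_false_iff_not] at hh
      obtain ⟨⟨⟨⟨hmv, h12⟩, ht⟩, hnu'⟩, hval⟩ := hh
      rw [pterm_eq, pterm_eq, prod_pow_pair hle h12 hnu', hnu, ht]
      have hP : (∏ m : Fin 4, b m ^ (v₁.1 m.castSucc - γ' m)) ≠ 0 := by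
        refine prod_pow_ne_zero fun m hm => hN m (hmv ?_)
        simp only [moves, Finset.mem_filter, Finset.mem_univ, true_and] at hm ⊢
        exact lt_of_lt_of_le hm (h12 m)
      have hval' : f (v₁.2 * binomK γ' v₁.1 + v₂.2 * binomK γ' v₂.1 * κ) ≠ 0 :=
        (map_ne_zero_iff f f.injective).mpr hval
      intro h0
      apply mul_ne_zero (mul_ne_zero hval' (pow_ne_zero (v₂.1 (Fin.last 4)) hβ)) hP
      rw [map_add, map_mul, map_mul, map_mul]
      linear_combination h0
    rcases h with h1 | h2
    · exact key (hsrc u₁ (by simp)) h1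
    · rw [add_comm]; exact key (hsrc u₂ (by simp)) h2
  · exact absurd h Bool.false_ne_true

omit [Field k] [DecidableEq k] [Field K] [DecidableEq K] in
/-- sources listed by `srcTerms` dominate `γ`. OURS. [folklore] -/
theorem le_of_mem_srcTerms {U : Finset (Fin 4)} {γ : Fin 4 → ℕ} {G : Terms 5 k} {u : (Fin 5 → ℕ) × k}
    (hu : u ∈ srcTerms U γ G) (i : Fin 4) : γ i ≤ u.1 i.castSucc := by
  unfold srcTerms at hu
  rw [List.mem_filter] at hu
  have := hu.2
  simp only [isSrcB, Bool.and_eq_true, decide_eq_true_eq] at this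
  exact this.1 i

omit [DecidableEq K] in
/-- **a relation check splits**: if the coefficients of `x^γ` AND `x^{γ'}` vanish at `b` (vanishing off `U`), some
coordinate in `zs` vanishes. OURS. [folklore] -/
theorem exists_zero_of_prelB {q : ℕ} {U : Finset (Fin 4)} {G : Terms 5 k} {γ γ' : Fin 4 → ℕ} {zs : Finset (Fin 4)}
    {nu : Fin 4 → ℕ} {κ : k} (hβ : β ≠ 0) (h : prelB q U G γ γ' zs nu κ = true) {b : Fin 4 → K}
    (hb : ∀ m : Fin 4, m ∉ U → b m = 0)
    (hzero : coeff (expo γ) (PointBlowup.translate b (spec f β (evalT G))) = 0)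
    (hzero' : coeff (expo γ') (PointBlowup.translate b (spec f β (evalT G))) = 0) : ∃ i ∈ zs, b i = 0 := by
  by_contra hcon
  push Not at hcon
  unfold prelB at h
  simp only [Bool.and_eq_true] at h
  obtain ⟨⟨-, hm⟩, hkill⟩ := h
  rw [coeff_translate_spec_evalT, sum_pterm_filter f β γ hb] at hzero
  rw [coeff_translate_spec_evalT, sum_pterm_filter f β γ' hb] at hzero'
  have hsrc' : ∀ u ∈ srcTerms U γ' G, ∀ i : Fin 4, γ' i ≤ u.1 i.castSucc := fun u hu => le_of_mem_srcTerms hu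
  -- the relation from γ, and κ ≠ 0
  have hboth : (∏ m : Fin 4, b m ^ nu m) = f κ ∧ κ ≠ 0 := by
    have hsrc : ∀ u ∈ srcTerms U γ G, ∀ i : Fin 4, γ i ≤ u.1 i.castSucc := fun u hu => le_of_mem_srcTerms hu
    unfold srcTerms at hm hsrc
    split at hm
    · rename_i t₁ t₂ heq
      rw [heq] at hzero hsrc
      simp only [List.map_cons, List.map_nil, List.sum_cons, List.sum_nil, add_zero] at hzero
      rw [Bool.or_eq_true] at hm
      rcases hm with h1 | h2
      · exact ⟨prod_nu_eq_of_relCoreB f β hβ h1 (hsrc t₁ (by simp)) hcon hzero, kappa_ne_zero_of_relCoreB h1⟩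
      · exact ⟨prod_nu_eq_of_relCoreB f β hβ h2 (hsrc t₂ (by simp)) hcon (by rw [add_comm]; exact hzero),
          kappa_ne_zero_of_relCoreB h2⟩
    · exact absurd hm Bool.false_ne_true
  obtain ⟨hnu, hκ0⟩ := hboth
  -- all of N is non-zero
  have hN : ∀ m ∈ zs ∪ Finset.univ.filter (fun m => nu m ≠ 0), b m ≠ 0 := by
    intro m hm
    rcases Finset.mem_union.mp hm with h1 | h2
    · exact hcon m h1
    · simp only [Finset.mem_filter, Finset.mem_univ, true_and] at h2
      intro hbm
      have : (∏ m : Fin 4, b m ^ nu m) = 0 := Finset.prod_eq_zero (Finset.mem_univ m) (by rw [hbm, zero_pow h2])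
      rw [this] at hnu
      exact hκ0 ((map_eq_zero_iff f f.injective).mp hnu.symm)
  exact (sum_ne_zero_of_relKillB f β hβ hkill hsrc' hN hnu) hzero'

end ParamLift

end Summit.ResolutionOfSingularities.ResolutionOfSingularities.Theorems.PIDim4

end
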